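import Summits.AtomisticToContinuum.HydrodynamicLimit.Theorems.OneFlightGossipEngineCollisionActivityTailsOneWindow
import Summits.AtomisticToContinuum.HydrodynamicLimit.Theorems.OneFlightGossipEngineCollisionActivityTailsNearFieldKineticTails
import Summits.AtomisticToContinuum.HydrodynamicLimit.Theorems.OneFlightGossipEngineCollisionActivityTailsCrowdedActivityMeasurable
import HarnessLib

/-!
# `CollisionActivityTails` (stmt-AtomisticToContinuum-13734), line `SketchK1`: the line's two tail-shaped stubs are
window-convex — one good window scale suffices for `NearFieldKineticTails` and `CrowdedCollisionTails`

Helper file (`--supports stmt-AtomisticToContinuum-13734`; registered helper sub-goal `stub_tailStubsOneWindow`) for the crux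
`Summit.AtomisticToContinuum.HydrodynamicLimit.Theses.OneFlightGossipEngine.CollisionActivityTails` (≡ the TwoClocks copy), line
`SketchK1`. File 3 after `…ActMeasurable` (window algebra of the activity) and `…OneWindow` (`TailStatement F ↔
OneWindowTailStatement F` for every `WindowConvex F`). Here the two OPEN tail-shaped statements of the line get the same
reduction:

* §6 `nearFieldKinetic` (the window AVERAGE `F²_i = w⁻¹ ∫_s^{s+w} Σ_{j ≠ i, near} |v_j − v_i|² dt`) is window-convex: window
  averages over `(K+1)` adjacent windows are averages of the one-window averages (`intervalIntegral.sum_integral_adjacent_intervals`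
  on the good set, where the integrand is interval integrable), and the average over an intermediate window is at most twice the
  longer one (nonnegative integrand); measurability of its tail sums is the landed `aemeasurable_sum_tailFn_nearFieldKinetic` (p90029).
* §7 `crowdedActivity` (`Fcr_i = (σ/τ) ×` a window collision PAIR sum) is window-convex: additivity / monotonicity of the pair sum
  over adjacent windows on the good set (`collisionPairSum_union`), exactly as for the activity in file 1; measurability of its tail
  sums is the landed `aemeasurable_sum_tailFn_crowdedActivity` (p110232).
* §8 Corollaries: `NearFieldKineticTails` (the landed statement of p106773, with its measurability conjunct) `↔ TailStatement F² ↔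
  OneWindowTailStatement F²`, and `TailStatement Fcr ↔ OneWindowTailStatement Fcr` (the skeleton's `CrowdedCollisionTails` is
  `TailStatement Fcr` definitionally). So a proof of either open stub need only exhibit, per level and accuracy, ONE mesoscopic
  window scale that is good uniformly in the start and in large `N`.

References: C. Cercignani, R. Illner, M. Pulvirenti, *The Mathematical Theory of Dilute Gases* (1994), §4.2, App. 4.A (time
averages and collision sums along the hard-sphere flow); H. Spohn, *Large Scale Dynamics of Interacting Particles* (1991), Part I
§2.3. Elementary; recorded here.
-/

noncomputable section

open MeasureTheory Set Filter Topology
open scoped ENNReal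

namespace Summit.AtomisticToContinuum.HydrodynamicLimit.Theorems.CollisionActivityTailsWindowAlgebra

open Literature.MathematicalPhysics.KineticTheory Literature.Analysis.FluidPDE
open Summit.AtomisticToContinuum.HydrodynamicLimit.Theorems.CollisionActivityTailsActivityDomination
open Summit.AtomisticToContinuum.HydrodynamicLimit.Theorems.CollisionActivityTailsNearFieldKineticTails (tailFn tailFn_nonneg
  aemeasurable_sum_tailFn_nearFieldKinetic)
open Summit.AtomisticToContinuum.HydrodynamicLimit.Theorems.CollisionActivityTailsCrowdedActivityMeasurable
  (aemeasurable_sum_tailFn_crowdedActivity)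

variable {σ : ℝ} {N : ℕ}

/-! ## §6 The window-averaged near-field kinetic energy is window-convex -/

/-- **Additivity of window averages**: over `K + 1` windows the average is the average of the one-window averages (good set). -/
theorem nearFieldKinetic_succ_mul_eq_avg (Φ : Flow σ N) {z : Cfg N} (hz : z ∈ Φ.good) {τ₁ : ℝ} (hτ₁ : 0 < τ₁) (s : ℝ)
    (i : Fin (N + 1)) (K : ℕ) :
    nearFieldKinetic Φ (((K : ℝ) + 1) * τ₁) s i z =
      ((K : ℝ) + 1)⁻¹ * ∑ k ∈ Finset.range (K + 1), nearFieldKinetic Φ τ₁ (s + k * window τ₁ N) i z := by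
  unfold nearFieldKinetic
  have hw : 0 < window τ₁ N := window_pos hτ₁ N
  have hadd := intervalIntegral.sum_integral_adjacent_intervals (μ := volume)
    (f := fun t => relKineticNear (Φ.flow t z) i (2 * hsDiameter σ N)) (a := fun k : ℕ => s + k * window τ₁ N) (n := K + 1)
    (fun k _ => intervalIntegrable_relKineticNear Φ hz i _ _ _ (by push_cast; nlinarith))
  simp only [Nat.cast_zero, zero_mul, add_zero] at hadd
  push_cast at hadd
  rw [window_mul, ← hadd, Finset.mul_sum, Finset.mul_sum]
  refine Finset.sum_congr rfl fun k _ => ?_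
  have hk : s + ((k : ℝ) + 1) * window τ₁ N = s + k * window τ₁ N + window τ₁ N := by ring
  rw [hk]
  have hK : (K : ℝ) + 1 ≠ 0 := by positivity
  field_simp

/-- **Intermediate windows**: for `K τ₁ ≤ τ ≤ (K+1) τ₁`, `K ≥ 1`, the window average over `w(τ)` is at most twice the
average over `w((K+1)τ₁)` (nonnegative integrand, `w((K+1)τ₁) ≤ 2 w(τ)`; good set). -/
theorem nearFieldKinetic_le_two_mul (Φ : Flow σ N) {z : Cfg N} (hz : z ∈ Φ.good) {τ₁ τ : ℝ} (hτ₁ : 0 < τ₁) {K : ℕ}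
    (hK : 1 ≤ K) (hKτ : (K : ℝ) * τ₁ ≤ τ) (hτK : τ ≤ ((K : ℝ) + 1) * τ₁) (s : ℝ) (i : Fin (N + 1)) :
    nearFieldKinetic Φ τ s i z ≤ 2 * nearFieldKinetic Φ (((K : ℝ) + 1) * τ₁) s i z := by
  unfold nearFieldKinetic
  have hK1 : (1 : ℝ) ≤ K := by exact_mod_cast hK
  have hτ : 0 < τ := lt_of_lt_of_le (by positivity) hKτ
  set w := window τ N with hw
  set w' := window (((K : ℝ) + 1) * τ₁) N with hw'
  have hw0 : 0 < w := window_pos hτ N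
  have hww' : w ≤ w' := window_le_window hτK N
  have hw'2 : w' ≤ 2 * w := by
    have h2 : ((K : ℝ) + 1) * τ₁ ≤ 2 * τ := by nlinarith
    calc w' ≤ window (2 * τ) N := window_le_window h2 N
      _ = 2 * w := window_mul 2 τ N
  have hw'0 : 0 < w' := hw0.trans_le hww'
  set r : ℝ → ℝ := fun t => relKineticNear (Φ.flow t z) i (2 * hsDiameter σ N) with hr
  have hI : ∫ t in s..(s + w), r t ≤ ∫ t in s..(s + w'), r t :=
    intervalIntegral.integral_mono_interval le_rfl (by linarith) (by linarith)
      (ae_of_all _ fun t => relKineticNear_nonneg _ _ _) (intervalIntegrable_relKineticNear Φ hz i _ _ _ (by linarith))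
  have hJ0 : 0 ≤ ∫ t in s..(s + w'), r t :=
    intervalIntegral.integral_nonneg (by linarith) fun t _ => relKineticNear_nonneg _ _ _
  have hinv : w⁻¹ ≤ 2 * w'⁻¹ := by
    have h1 : (2 * w)⁻¹ ≤ w'⁻¹ := inv_anti₀ hw'0 hw'2
    calc w⁻¹ = 2 * (2 * w)⁻¹ := by field_simp
      _ ≤ 2 * w'⁻¹ := by linarith
  calc w⁻¹ * ∫ t in s..(s + w), r t ≤ w⁻¹ * ∫ t in s..(s + w'), r t :=
        mul_le_mul_of_nonneg_left hI (inv_nonneg.2 hw0.le)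
    _ ≤ 2 * w'⁻¹ * ∫ t in s..(s + w'), r t := mul_le_mul_of_nonneg_right hinv hJ0
    _ = 2 * (w'⁻¹ * ∫ t in s..(s + w'), r t) := by ring

/-- **`F²` is window-convex** (measurability of its tail sums: the landed `aemeasurable_sum_tailFn_nearFieldKinetic`, every `σ`). -/
theorem windowConvex_nearFieldKinetic : WindowConvex (fun Φ τ s i z => nearFieldKinetic Φ τ s i z) where
  nonneg Φ _ s i z _ hτ := nearFieldKinetic_nonneg Φ hτ s i z
  le_two_mul_avg Φ _ _ hz _ _ hτ₁ K hK hKτ hτK s i := by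
    rw [← nearFieldKinetic_succ_mul_eq_avg Φ hz hτ₁ s i K]
    exact nearFieldKinetic_le_two_mul Φ hz hτ₁ hK hKτ hτK s i
  aemeasurable := ⟨1, one_pos, fun {σ} _ _ a₀ θ₀ u₀ N Φ τ _ s V =>
    aemeasurable_sum_tailFn_nearFieldKinetic σ a₀ θ₀ u₀ N Φ τ s V⟩

/-! ## §7 The crowded collisional activity is window-convex -/

/-- The summand of `Fcr_i` (verbatim from `crowdedActivity`): the impulse of the ordered pair `(k, l)` when both partners lie
within `3ε` of `x_i` and at least three centres crowd that ball. -/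
def crowdSummand (σ : ℝ) (N : ℕ) (i : Fin (N + 1)) : ℝ → Cfg N → Fin (N + 1) → Fin (N + 1) → ℝ :=
  fun t y k l =>
    if tdist (y k).1 (y i).1 ≤ 3 * hsDiameter σ N ∧ tdist (y l).1 (y i).1 ≤ 3 * hsDiameter σ N ∧
        3 ≤ nearCount y i (3 * hsDiameter σ N) then
      ‖(HardSphereCollisionRecord.ofConfig (Torus.geometry (Fin 3)) (hsDiameter σ N) y t k l).postVel.1 -
        (HardSphereCollisionRecord.ofConfig (Torus.geometry (Fin 3)) (hsDiameter σ N) y t k l).preVel.1‖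
    else 0

/-- The un-normalised crowded impulse near `i` over the times in `S`. -/
def crowdSum (Φ : Flow σ N) (S : Set ℝ) (i : Fin (N + 1)) (z : Cfg N) : ℝ :=
  Φ.collisionPairSum S (crowdSummand σ N i) z

/-- `Fcr_i = (σ/τ) ×` the crowded impulse over the window (definitional). -/
theorem crowdedActivity_eq_crowdSum (Φ : Flow σ N) (τ s : ℝ) (i : Fin (N + 1)) (z : Cfg N) :
    crowdedActivity Φ τ s i z = σ / τ * crowdSum Φ (Ioc s (s + window τ N)) i z := rfl

/-- The crowded summand is nonnegative. -/
theorem crowdSummand_nonneg (σ : ℝ) (N : ℕ) (i : Fin (N + 1)) (t : ℝ) (y : Cfg N) (k l : Fin (N + 1)) :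
    0 ≤ crowdSummand σ N i t y k l := by
  unfold crowdSummand
  split_ifs <;> positivity

/-- The crowded impulse is nonnegative. -/
theorem crowdSum_nonneg (Φ : Flow σ N) (S : Set ℝ) (i : Fin (N + 1)) (z : Cfg N) : 0 ≤ crowdSum Φ S i z :=
  collisionPairSum_nonneg Φ S (fun t y k l => crowdSummand_nonneg σ N i t y k l) z

/-- **Additivity over adjacent windows** of the crowded impulse on the good set. -/
theorem crowdSum_Ioc_add (Φ : Flow σ N) {z : Cfg N} (hz : z ∈ Φ.good) {a b c : ℝ} (hab : a ≤ b) (hbc : b ≤ c)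
    (i : Fin (N + 1)) :
    crowdSum Φ (Ioc a c) i z = crowdSum Φ (Ioc a b) i z + crowdSum Φ (Ioc b c) i z := by
  unfold crowdSum HardSphereFlow.collisionPairSum
  rw [← Ioc_union_Ioc_eq_Ioc hab hbc,
    collisionPairSum_union (Φ.finite_collisionTimes_inter hz Ioc_subset_Icc_self)
      (Φ.finite_collisionTimes_inter hz Ioc_subset_Icc_self) (Ioc_disjoint_Ioc_of_le le_rfl)]

/-- Monotonicity of the crowded impulse in the right endpoint of the window (good set). -/
theorem crowdSum_Ioc_mono (Φ : Flow σ N) {z : Cfg N} (hz : z ∈ Φ.good) {a b c : ℝ} (hab : a ≤ b) (hbc : b ≤ c)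
    (i : Fin (N + 1)) : crowdSum Φ (Ioc a b) i z ≤ crowdSum Φ (Ioc a c) i z := by
  rw [crowdSum_Ioc_add Φ hz hab hbc i]
  linarith [crowdSum_nonneg Φ (Ioc b c) i z]

/-- The crowded impulse over `(s, s + (K+1) w]` is the sum over the `K + 1` adjacent windows of length `w ≥ 0`. -/
theorem crowdSum_Ioc_eq_sum (Φ : Flow σ N) {z : Cfg N} (hz : z ∈ Φ.good) {w : ℝ} (hw : 0 ≤ w) (s : ℝ)
    (i : Fin (N + 1)) (K : ℕ) :
    crowdSum Φ (Ioc s (s + ((K : ℝ) + 1) * w)) i z =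
      ∑ k ∈ Finset.range (K + 1), crowdSum Φ (Ioc (s + k * w) (s + ((k : ℝ) + 1) * w)) i z := by
  induction K with
  | zero => simp
  | succ K ih =>
    rw [Finset.sum_range_succ, ← ih, crowdSum_Ioc_add Φ hz (b := s + ((K : ℝ) + 1) * w)]
    · push_cast
      ring_nf
    · nlinarith
    · push_cast
      nlinarith

/-- **`Fcr` over `K + 1` windows is the average of the `K + 1` adjacent one-window values** (good set). -/
theorem crowdedActivity_succ_mul_eq_avg (Φ : Flow σ N) {z : Cfg N} (hz : z ∈ Φ.good) {τ₁ : ℝ} (hτ₁ : 0 < τ₁) (s : ℝ)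
    (i : Fin (N + 1)) (K : ℕ) :
    crowdedActivity Φ (((K : ℝ) + 1) * τ₁) s i z =
      ((K : ℝ) + 1)⁻¹ * ∑ k ∈ Finset.range (K + 1), crowdedActivity Φ τ₁ (s + k * window τ₁ N) i z := by
  have hw : 0 ≤ window τ₁ N := (window_pos hτ₁ N).le
  rw [crowdedActivity_eq_crowdSum, window_mul, crowdSum_Ioc_eq_sum Φ hz hw s i K, Finset.mul_sum, Finset.mul_sum]
  refine Finset.sum_congr rfl fun k _ => ?_
  rw [crowdedActivity_eq_crowdSum]
  have hK : (K : ℝ) + 1 ≠ 0 := by positivity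
  have h1 : s + ((k : ℝ) + 1) * window τ₁ N = s + k * window τ₁ N + window τ₁ N := by ring
  rw [h1]
  field_simp

/-- **Intermediate windows** for `Fcr`: `Fcr(τ) ≤ 2 Fcr((K+1)τ₁)` for `K τ₁ ≤ τ ≤ (K+1) τ₁`, `K ≥ 1` (good set, `σ ≥ 0`). -/
theorem crowdedActivity_le_two_mul (hσ : 0 ≤ σ) (Φ : Flow σ N) {z : Cfg N} (hz : z ∈ Φ.good) {τ₁ τ : ℝ} (hτ₁ : 0 < τ₁)
    {K : ℕ} (hK : 1 ≤ K) (hKτ : (K : ℝ) * τ₁ ≤ τ) (hτK : τ ≤ ((K : ℝ) + 1) * τ₁) (s : ℝ) (i : Fin (N + 1)) :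
    crowdedActivity Φ τ s i z ≤ 2 * crowdedActivity Φ (((K : ℝ) + 1) * τ₁) s i z := by
  have hK1 : (1 : ℝ) ≤ K := by exact_mod_cast hK
  have hτ : 0 < τ := lt_of_lt_of_le (by positivity) hKτ
  rw [crowdedActivity_eq_crowdSum, crowdedActivity_eq_crowdSum]
  set I := crowdSum Φ (Ioc s (s + window τ N)) i z with hI
  set J := crowdSum Φ (Ioc s (s + window (((K : ℝ) + 1) * τ₁) N)) i z with hJ
  have hIJ : I ≤ J :=
    crowdSum_Ioc_mono Φ hz (by linarith [(window_pos hτ N).le]) (by linarith [window_le_window hτK N]) i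
  have hJ0 : 0 ≤ J := crowdSum_nonneg Φ _ i z
  have hkey : ((K : ℝ) + 1) * τ₁ / 2 ≤ τ := by nlinarith
  have hpos : 0 < ((K : ℝ) + 1) * τ₁ / 2 := by positivity
  calc σ / τ * I ≤ σ / τ * J := mul_le_mul_of_nonneg_left hIJ (div_nonneg hσ hτ.le)
    _ ≤ σ / (((K : ℝ) + 1) * τ₁ / 2) * J :=
        mul_le_mul_of_nonneg_right (div_le_div_of_nonneg_left hσ hpos hkey) hJ0
    _ = 2 * (σ / (((K : ℝ) + 1) * τ₁) * J) := by
        rw [div_div_eq_mul_div]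
        ring

/-- **`Fcr` is window-convex** (measurability of its tail sums: the landed `aemeasurable_sum_tailFn_crowdedActivity`, every `σ`). -/
theorem windowConvex_crowdedActivity : WindowConvex (fun Φ τ s i z => crowdedActivity Φ τ s i z) where
  nonneg Φ _ s i z hσ hτ := crowdedActivity_nonneg hσ.le Φ hτ.le s i z
  le_two_mul_avg Φ _ hσ hz _ _ hτ₁ K hK hKτ hτK s i := by
    rw [← crowdedActivity_succ_mul_eq_avg Φ hz hτ₁ s i K]
    exact crowdedActivity_le_two_mul hσ.le Φ hz hτ₁ hK hKτ hτK s i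
  aemeasurable := ⟨1, one_pos, fun {σ} _ _ a₀ θ₀ u₀ N Φ τ _ s V =>
    aemeasurable_sum_tailFn_crowdedActivity σ a₀ θ₀ u₀ N Φ τ s V⟩

/-! ## §8 One good window suffices for the two tail-shaped stubs -/

/-- The landed statement `NearFieldKineticTails` (p106773, with its a.e.-measurability conjunct, which holds for all data) is the tail
statement of `F²`. -/
theorem nearFieldKineticTails_iff_tailStatement :
    CollisionActivityTailsNearFieldKineticTails.NearFieldKineticTails ↔
      TailStatement (fun Φ τ s i z => nearFieldKinetic Φ τ s i z) := by
  constructor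
  · intro h a₀ θ₀ u₀ ha hθ hu ha0 hθ0
    obtain ⟨σ₀, hσ₀, h⟩ := h a₀ θ₀ u₀ ha hθ hu ha0 hθ0
    refine ⟨σ₀, hσ₀, fun σ hσ hσlt T ρ θ u hsol Φ hLLN t ht => ?_⟩
    obtain ⟨V₀, hV₀, h⟩ := h σ hσ hσlt T ρ θ u hsol Φ hLLN t ht
    refine ⟨V₀, hV₀, fun V hV ε hε => ?_⟩
    obtain ⟨τ₀, hτ₀, h⟩ := h V hV ε hε
    refine ⟨τ₀, hτ₀, fun τ hτ => ?_⟩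
    obtain ⟨N₀, h⟩ := h τ hτ
    exact ⟨N₀, fun N hN s hs => (h N hN s hs).2⟩
  · intro h a₀ θ₀ u₀ ha hθ hu ha0 hθ0
    obtain ⟨σ₀, hσ₀, h⟩ := h a₀ θ₀ u₀ ha hθ hu ha0 hθ0
    refine ⟨σ₀, hσ₀, fun σ hσ hσlt T ρ θ u hsol Φ hLLN t ht => ?_⟩
    obtain ⟨V₀, hV₀, h⟩ := h σ hσ hσlt T ρ θ u hsol Φ hLLN t ht
    refine ⟨V₀, hV₀, fun V hV ε hε => ?_⟩
    obtain ⟨τ₀, hτ₀, h⟩ := h V hV ε hε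
    refine ⟨τ₀, hτ₀, fun τ hτ => ?_⟩
    obtain ⟨N₀, h⟩ := h τ hτ
    exact ⟨N₀, fun N hN s hs => ⟨aemeasurable_sum_tailFn_nearFieldKinetic σ a₀ θ₀ u₀ N (Φ N) τ s V, h N hN s hs⟩⟩

/-- **ONE GOOD WINDOW SUFFICES for stub 5**: `NearFieldKineticTails ↔ OneWindowTailStatement F²`. -/
theorem nearFieldKineticTails_iff_oneWindow :
    CollisionActivityTailsNearFieldKineticTails.NearFieldKineticTails ↔
      OneWindowTailStatement (fun Φ τ s i z => nearFieldKinetic Φ τ s i z) :=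
  nearFieldKineticTails_iff_tailStatement.trans (tailStatement_iff_oneWindow windowConvex_nearFieldKinetic)

/-- **ONE GOOD WINDOW SUFFICES for stub 6**: `TailStatement Fcr ↔ OneWindowTailStatement Fcr` (the skeleton's `CrowdedCollisionTails`
is `TailStatement Fcr` definitionally). -/
theorem crowdedCollisionTails_iff_oneWindow :
    TailStatement (fun Φ τ s i z => crowdedActivity Φ τ s i z) ↔
      OneWindowTailStatement (fun Φ τ s i z => crowdedActivity Φ τ s i z) :=
  tailStatement_iff_oneWindow windowConvex_crowdedActivity

/-- **TAIL STUBS — ONE-WINDOW FORMS** (registered helper sub-goal `stub_tailStubsOneWindow` of line `SketchK1`): the line's two open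
tail-shaped statements are equivalent to their one-window forms. -/
def TailStubsOneWindow : Prop :=
  (CollisionActivityTailsNearFieldKineticTails.NearFieldKineticTails ↔
      OneWindowTailStatement (fun Φ τ s i z => nearFieldKinetic Φ τ s i z)) ∧
    (TailStatement (fun Φ τ s i z => crowdedActivity Φ τ s i z) ↔
      OneWindowTailStatement (fun Φ τ s i z => crowdedActivity Φ τ s i z))

/-- **STUB `stub_tailStubsOneWindow` (line `SketchK1`).** -/
theorem stub_tailStubsOneWindow : TailStubsOneWindow :=
  ⟨nearFieldKineticTails_iff_oneWindow, crowdedCollisionTails_iff_oneWindow⟩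

end Summit.AtomisticToContinuum.HydrodynamicLimit.Theorems.CollisionActivityTailsWindowAlgebra

end
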